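import Literature.Barriers.NavierStokesRegularity.NavierStokesInequalityCantorPressure
import Literature.Barriers.NavierStokesRegularity.NavierStokesInequalityGluingWeak
import Literature.Analysis.FluidPDE.ClassicalNSILocalEnergy
import HarnessLib

/-!
# Scheffer's Cantor-set switching: the glued field is a weak NSI solution — discharge of `NSICantorSwitching`

Barrier catalogue support file for `NavierStokesRegularity` (D-0021), last layer of the
decomposition of `Literature.Barriers.NavierStokesRegularity.NavierStokesInequalityNearlyOneDimSingularSet`
(Scheffer 1987 = Ożański 2020 Thm. 1.6). The Cantor switching principle A′ =
`NSICantorSwitching` of the accepted `NavierStokesInequalityCantorSwitching` (Ożański 2017,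
§6.2, (6.18) and p. 30: "we obtain a solution to Theorem 14. Indeed, that `𝔲` is a weak solution
to the NSI follows as in the case of Theorem 1"; Scheffer 1987, (5.39), Lemmas 5.9–5.13) is
PROVED (`NSICantorSwitching_holds`): the glued field `𝔲 = Scheffer.glueSeq T τ w` of a Cantor
block, with its pressure function `p̃[𝔲(t)]` and its classical slice gradient `D(𝔲(t))`,
satisfies the hypotheses of the accepted abstract **gluing principle**
`isWeakNSISolution_of_piecewise` (`NavierStokesInequalityGluingWeak`; Ożański 2017, §1 (1.6),
§2 pp. 6–7; Scheffer 1985, Lemma 2.3): the per-piece local energy inequality with boundary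
terms is the tree's `nsi_localEnergyIneq_Icc` (`ClassicalNSILocalEnergy`, Ożański's (1.5))
applied to the classical NSI pieces (6.15), the drops are (6.16), the pressure clause is
`NormalisedPressureCompactSupport`, and the integrability package (Ożański p. 6 / Scheffer's
Lemma 5.12) is `NavierStokesInequalityCantorGradient` (`𝔲, ∇𝔲 ∈ L¹`, `|∇𝔲|² ∈ L¹`),
`NavierStokesInequalityCantorCube` (`|𝔲|³ ∈ L¹`) and `NavierStokesInequalityCantorPressure`
(`|p̃||𝔲| ∈ L¹`, measurability of `p̃`). Consequently the barrier fact follows from the Cantor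
block alone: `navierStokesInequalityNearlyOneDimSingularSet_of_blockExists :
NSICantorBlockExists → NavierStokesInequalityNearlyOneDimSingularSet` — the trust base of
Scheffer's 1987 theorem in the tree is the single named fact B′ (Ożański 2017, §6.5 + Prop. 16).
Everything in this file is PROVED; no definitions.

## References

* W. S. Ożański, arXiv:1709.00602 (2017), §1 (1.5)–(1.6), §2 pp. 6–7, §6.2 (6.15)–(6.18), p. 30.
  [`Ozanski2017NSISingular`]
* V. Scheffer, Comm. Math. Phys. 110 (1987), (5.39), Lemmas 5.9–5.13, p. 551. [`Scheffer1987`]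
* W. S. Ożański, Comm. Math. Phys. 374 (2020), Def. 1.1, Thm. 1.6. [`Ozanski2019NSI`]
-/

noncomputable section

open MeasureTheory Set Function Filter Topology TopologicalSpace Metric
open Literature.MeasureTheory.Hausdorff Literature.Analysis.FluidPDE
open scoped ENNReal NNReal InnerProductSpace RealInnerProductSpace ContDiff Laplacian

namespace Literature.Barriers.NavierStokesRegularity

open Scheffer

namespace IsNSICantorBlock

variable {T ν₀ τ : ℝ} {M : ℕ} {d : Fin M → (EuclideanSpace ℝ (Fin 3))} {G : Set (EuclideanSpace ℝ (Fin 3))} {w : ℕ → ℝ → (EuclideanSpace ℝ (Fin 3)) → (EuclideanSpace ℝ (Fin 3))}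

/-! ### The per-piece local energy inequality with boundary terms ((6.15) ⇒ (1.5)) -/

/-- **The local energy inequality with boundary terms for the `j`-th piece on `[t_j, t_{j+1}]`**,
for every `ν ∈ [0, ν₀]` and every nonnegative space–time test function: the tree's
`nsi_localEnergyIneq_Icc` for the classical NSI piece `w j` ((6.15), supported in `G`,
divergence free, jointly smooth on an open slab), with its pressure function `p̃[w j(t)]`
(`C²`, jointly continuous). (Ożański 2017, (1.5) for `u^{(j)}`; Scheffer 1987, Lemma 5.9.)
[cite: Ozanski2017NSISingular, §1 (1.5) and §6.2 (6.15)] [cite: Scheffer1987, Lemma 5.9] -/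
theorem localEnergyIneq_piece (h : IsNSICantorBlock T ν₀ τ M d G w) {ν : ℝ} (hν : ν ∈ Icc 0 ν₀)
    (j : ℕ) {φ : ℝ → (EuclideanSpace ℝ (Fin 3)) → ℝ} (hφ : IsSpaceTimeTestOn (⊤ : Opens (ℝ × (EuclideanSpace ℝ (Fin 3)))) φ)
    (hφ0 : ∀ s x, 0 ≤ φ s x) :
    (∫ x, ‖w j (switchTime T τ (j + 1)) x‖ ^ 2 * φ (switchTime T τ (j + 1)) x) -
        (∫ x, ‖w j (switchTime T τ j) x‖ ^ 2 * φ (switchTime T τ j) x) +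
        2 * ν * ∫ s in Ioo (switchTime T τ j) (switchTime T τ (j + 1)), ∫ x,
          frobeniusNormSq (fderiv ℝ (w j s) x) * φ s x ≤
      ∫ s in Ioo (switchTime T τ j) (switchTime T τ (j + 1)), ∫ x,
        (‖w j s x‖ ^ 2 * (timeDeriv φ s x + ν * Δ (φ s) x) +
          (‖w j s x‖ ^ 2 + 2 * normalisedPressure (w j s) x) * ⟪w j s x, gradient (φ s) x⟫) := by
  obtain ⟨η, hη, hsm⟩ := h.smooth j
  have hlt := h.switchTime_lt j
  exact nsi_localEnergyIneq_Icc (p := fun t => normalisedPressure (w j t)) hlt.le isOpen_Ioo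
    (fun s hs => ⟨by linarith [hs.1], by linarith [hs.2]⟩) hsm h.isCompact
    (fun s hs x hx => h.piece_apply_eq_zero hs hx) (fun s hs => h.divFree j s hs)
    (fun s hs => (contDiff_normalisedPressure_of_hasCompactSupport (h.contDiff_piece hs)
      (h.hasCompactSupport_piece hs)).of_le one_le_two)
    (h.continuousOn_normalisedPressure_piece j) (fun s hs x => h.nsi j ν hν s hs x) hφ hφ0

/-! ### Global integrability on `(0,∞) × ℝ³` (the package of Ożański p. 6 / Scheffer's Lemma 5.12) -/

/-- The compact space–time box `[0, T₀] × G` off which the glued field vanishes. [folklore] -/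
theorem isCompact_box (h : IsNSICantorBlock T ν₀ τ M d G w) :
    IsCompact (Icc (0 : ℝ) (blowupTime T τ) ×ˢ G) :=
  isCompact_Icc.prod h.isCompact

/-- Off the box `[0, T₀] × G` the glued field vanishes. [folklore] -/
theorem glueSeq_eq_zero_of_notMem_box (h : IsNSICantorBlock T ν₀ τ M d G w) {z : ℝ × (EuclideanSpace ℝ (Fin 3))}
    (hz : z ∉ Icc (0 : ℝ) (blowupTime T τ) ×ˢ G) : uncurry (glueSeq T τ w) z = 0 := by
  obtain ⟨t, x⟩ := z
  simp only [mem_prod, mem_Icc, not_and_or, not_le] at hz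
  simp only [uncurry_apply_pair]
  rcases hz with (ht | ht) | hx
  · rw [glueSeq_eq_zero_of_neg h.T_pos h.τ_pos w ht]; rfl
  · rw [glueSeq_eq_zero_of_le h.T_pos h.τ_pos h.τ_lt_one w ht.le]; rfl
  · exact h.glueSeq_apply_eq_zero t hx

/-- Off the box `[0, T₀] × G` the slice gradient vanishes. [folklore] -/
theorem fderiv_glueSeq_eq_zero_of_notMem_box (h : IsNSICantorBlock T ν₀ τ M d G w) {z : ℝ × (EuclideanSpace ℝ (Fin 3))}
    (hz : z ∉ Icc (0 : ℝ) (blowupTime T τ) ×ˢ G) : uncurry (fun t x => fderiv ℝ (glueSeq T τ w t) x) z = 0 := by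
  obtain ⟨t, x⟩ := z
  simp only [mem_prod, mem_Icc, not_and_or, not_le] at hz
  simp only [uncurry_apply_pair]
  rcases hz with (ht | ht) | hx
  · rw [glueSeq_eq_zero_of_neg h.T_pos h.τ_pos w ht]; simp
  · rw [glueSeq_eq_zero_of_le h.T_pos h.τ_pos h.τ_lt_one w ht.le]; simp
  · exact image_eq_zero_of_notMem_tsupport fun hx' =>
      hx (h.tsupport_glueSeq_subset t (tsupport_fderiv_subset ℝ hx'))

/-- **`𝔲 ∈ L¹(ℝ × ℝ³)`** (integrable on the compact box, zero off it). [folklore] -/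
theorem integrable_glueSeq (h : IsNSICantorBlock T ν₀ τ M d G w) :
    Integrable (uncurry (glueSeq T τ w)) (volume : Measure (ℝ × (EuclideanSpace ℝ (Fin 3)))) :=
  (h.integrableOn_glueSeq h.isCompact_box).integrable_of_forall_notMem_eq_zero
    fun _ hz => h.glueSeq_eq_zero_of_notMem_box hz

/-- **`∇𝔲 ∈ L¹(ℝ × ℝ³)`** (integrable on the compact box, zero off it). [folklore] -/
theorem integrable_fderiv_glueSeq (h : IsNSICantorBlock T ν₀ τ M d G w) :
    Integrable (uncurry (fun t x => fderiv ℝ (glueSeq T τ w t) x)) (volume : Measure (ℝ × (EuclideanSpace ℝ (Fin 3)))) := by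
  set B : Set (ℝ × (EuclideanSpace ℝ (Fin 3))) := Icc (0 : ℝ) (blowupTime T τ) ×ˢ G with hBdef
  have hB : MeasurableSet B := measurableSet_Icc.prod h.isCompact.measurableSet
  refine ⟨h.aestronglyMeasurable_fderiv_glueSeq, ?_⟩
  rw [hasFiniteIntegral_iff_enorm]
  have heq : (fun z : ℝ × (EuclideanSpace ℝ (Fin 3)) => ‖uncurry (fun t x => fderiv ℝ (glueSeq T τ w t) x) z‖ₑ) =
      B.indicator fun z => ‖uncurry (fun t x => fderiv ℝ (glueSeq T τ w t) x) z‖ₑ := by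
    funext z
    by_cases hz : z ∈ B
    · rw [indicator_of_mem hz]
    · rw [indicator_of_notMem hz, h.fderiv_glueSeq_eq_zero_of_notMem_box hz, ← ofReal_norm,
        ContinuousLinearMap.opNorm_zero, ENNReal.ofReal_zero]
  rw [heq, lintegral_indicator hB]
  exact (h.integrableOn_fderiv_glueSeq h.isCompact_box).hasFiniteIntegral

/-- **`|𝔲|² ∈ L¹((0,∞) × ℝ³)`**: `∫∫_{(0,∞)×ℝ³} |𝔲|² ≤ C T₀` (energy class on `(0,T₀)`, zero
from `T₀` on). [cite: Ozanski2017NSISingular, §2 (2.8)] -/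
theorem setLIntegral_enorm_sq_lt_top (h : IsNSICantorBlock T ν₀ τ M d G w) :
    ∫⁻ z in Ioi (0 : ℝ) ×ˢ (univ : Set (EuclideanSpace ℝ (Fin 3))), ‖uncurry (glueSeq T τ w) z‖ₑ ^ 2 < ⊤ := by
  obtain ⟨C, hC⟩ := h.lintegral_slab_enorm_sq_le
  have hcover : Ioi (0 : ℝ) ×ˢ (univ : Set (EuclideanSpace ℝ (Fin 3))) ⊆
      Ioo (0 : ℝ) (blowupTime T τ) ×ˢ univ ∪ Ici (blowupTime T τ) ×ˢ univ := by
    rintro ⟨t, x⟩ ⟨ht, -⟩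
    rcases lt_or_ge t (blowupTime T τ) with h1 | h1
    · exact Or.inl ⟨⟨ht, h1⟩, mem_univ _⟩
    · exact Or.inr ⟨h1, mem_univ _⟩
  have htail : ∫⁻ z in Ici (blowupTime T τ) ×ˢ (univ : Set (EuclideanSpace ℝ (Fin 3))), ‖uncurry (glueSeq T τ w) z‖ₑ ^ 2
      = 0 :=
    setLIntegral_eq_zero (measurableSet_Ici.prod MeasurableSet.univ) fun z hz => by
      obtain ⟨t, x⟩ := z
      simp [glueSeq_eq_zero_of_le h.T_pos h.τ_pos h.τ_lt_one w hz.1]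
  calc ∫⁻ z in Ioi (0 : ℝ) ×ˢ (univ : Set (EuclideanSpace ℝ (Fin 3))), ‖uncurry (glueSeq T τ w) z‖ₑ ^ 2
      ≤ ∫⁻ z in Ioo (0 : ℝ) (blowupTime T τ) ×ˢ univ ∪ Ici (blowupTime T τ) ×ˢ univ,
          ‖uncurry (glueSeq T τ w) z‖ₑ ^ 2 := lintegral_mono_set hcover
    _ ≤ (∫⁻ z in Ioo (0 : ℝ) (blowupTime T τ) ×ˢ (univ : Set (EuclideanSpace ℝ (Fin 3))), ‖uncurry (glueSeq T τ w) z‖ₑ ^ 2)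
          + ∫⁻ z in Ici (blowupTime T τ) ×ˢ (univ : Set (EuclideanSpace ℝ (Fin 3))), ‖uncurry (glueSeq T τ w) z‖ₑ ^ 2 :=
        lintegral_union_le _ _ _
    _ ≤ C * volume (Ioo (0 : ℝ) (blowupTime T τ)) + 0 := by
        rw [htail]
        exact add_le_add (hC _ measurableSet_Ioo) le_rfl
    _ < ⊤ := by
        rw [add_zero, Real.volume_Ioo]
        exact ENNReal.mul_lt_top ENNReal.coe_lt_top ENNReal.ofReal_lt_top

/-- `|𝔲|² ∈ L¹((0,∞) × ℝ³)` as a Bochner-integrable real function. [cite: Ozanski2017NSISingular, §2 (2.8)] -/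
theorem integrable_norm_sq (h : IsNSICantorBlock T ν₀ τ M d G w) :
    Integrable (fun z : ℝ × (EuclideanSpace ℝ (Fin 3)) => ‖glueSeq T τ w z.1 z.2‖ ^ 2)
      ((volume : Measure (ℝ × (EuclideanSpace ℝ (Fin 3)))).restrict (Ioi (0 : ℝ) ×ˢ (univ : Set (EuclideanSpace ℝ (Fin 3))))) := by
  refine ⟨(h.aestronglyMeasurable_glueSeq.aemeasurable.norm.pow_const 2).aestronglyMeasurable.restrict,
    ?_⟩
  rw [hasFiniteIntegral_iff_enorm]
  refine lt_of_le_of_lt (le_of_eq (lintegral_congr fun z => ?_)) h.setLIntegral_enorm_sq_lt_top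
  exact enorm_norm_sq _

/-- `|𝔲|³ ∈ L¹((0,∞) × ℝ³)` as a Bochner-integrable real function
(`NavierStokesInequalityCantorCube`). [cite: Scheffer1987, Lemma 5.12] -/
theorem integrable_norm_cube (h : IsNSICantorBlock T ν₀ τ M d G w) :
    Integrable (fun z : ℝ × (EuclideanSpace ℝ (Fin 3)) => ‖glueSeq T τ w z.1 z.2‖ ^ 3)
      ((volume : Measure (ℝ × (EuclideanSpace ℝ (Fin 3)))).restrict (Ioi (0 : ℝ) ×ˢ (univ : Set (EuclideanSpace ℝ (Fin 3))))) := by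
  refine ⟨(h.aestronglyMeasurable_glueSeq.aemeasurable.norm.pow_const 3).aestronglyMeasurable.restrict,
    ?_⟩
  rw [hasFiniteIntegral_iff_enorm]
  have hpt : ∀ z : ℝ × (EuclideanSpace ℝ (Fin 3)), ‖(‖glueSeq T τ w z.1 z.2‖ ^ 3 : ℝ)‖ₑ =
      ‖uncurry (glueSeq T τ w) z‖ₑ ^ (3 : ℝ) := fun z => by
    rw [show uncurry (glueSeq T τ w) z = glueSeq T τ w z.1 z.2 from rfl,
      Real.enorm_eq_ofReal (by positivity), ENNReal.ofReal_pow (norm_nonneg _), ofReal_norm,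
      ← ENNReal.rpow_natCast]
    norm_num
  calc ∫⁻ z in Ioi (0 : ℝ) ×ˢ (univ : Set (EuclideanSpace ℝ (Fin 3))), ‖(‖glueSeq T τ w z.1 z.2‖ ^ 3 : ℝ)‖ₑ
      = ∫⁻ z in Ioi (0 : ℝ) ×ˢ (univ : Set (EuclideanSpace ℝ (Fin 3))), ‖uncurry (glueSeq T τ w) z‖ₑ ^ (3 : ℝ) :=
        lintegral_congr hpt
    _ ≤ ∫⁻ z, ‖uncurry (glueSeq T τ w) z‖ₑ ^ (3 : ℝ) := setLIntegral_le_lintegral _ _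
    _ < ⊤ := h.lintegral_enorm_cube_lt_top

/-- `|p̃[𝔲]| |𝔲| ∈ L¹((0,∞) × ℝ³)` as a Bochner-integrable real function
(`NavierStokesInequalityCantorPressure`). [cite: Scheffer1987, Lemma 5.12] -/
theorem integrable_abs_pressure_mul_norm (h : IsNSICantorBlock T ν₀ τ M d G w) :
    Integrable (fun z : ℝ × (EuclideanSpace ℝ (Fin 3)) => |normalisedPressure (glueSeq T τ w z.1) z.2| * ‖glueSeq T τ w z.1 z.2‖)
      ((volume : Measure (ℝ × (EuclideanSpace ℝ (Fin 3)))).restrict (Ioi (0 : ℝ) ×ˢ (univ : Set (EuclideanSpace ℝ (Fin 3))))) := by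
  have hp := h.aestronglyMeasurable_normalisedPressure_glueSeq
  have hu : AEStronglyMeasurable (uncurry (glueSeq T τ w))
      ((volume : Measure (ℝ × (EuclideanSpace ℝ (Fin 3)))).restrict (Ioi (0 : ℝ) ×ˢ (univ : Set (EuclideanSpace ℝ (Fin 3))))) :=
    h.aestronglyMeasurable_glueSeq.restrict
  refine ⟨?_, ?_⟩
  · have := (hp.aemeasurable.norm.mul hu.aemeasurable.norm).aestronglyMeasurable
    refine this.congr (Eventually.of_forall fun z => ?_)
    simp only [Pi.mul_apply, Real.norm_eq_abs]
    rfl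
  · rw [hasFiniteIntegral_iff_enorm]
    refine lt_of_le_of_lt (le_of_eq (lintegral_congr fun z => ?_)) h.lintegral_pressure_mul_enorm_lt_top
    rw [enorm_mul, Real.enorm_abs, enorm_norm]

/-- `|∇𝔲|² ∈ L¹((0,∞) × ℝ³)` as a Bochner-integrable real function
(`NavierStokesInequalityCantorGradient`). [cite: Ozanski2017NSISingular, §2 (2.9)] -/
theorem integrable_frobeniusNormSq (h : IsNSICantorBlock T ν₀ τ M d G w) :
    Integrable (fun z : ℝ × (EuclideanSpace ℝ (Fin 3)) => frobeniusNormSq (fderiv ℝ (glueSeq T τ w z.1) z.2))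
      ((volume : Measure (ℝ × (EuclideanSpace ℝ (Fin 3)))).restrict (Ioi (0 : ℝ) ×ˢ (univ : Set (EuclideanSpace ℝ (Fin 3))))) := by
  refine ⟨((by unfold frobeniusNormSq; exact continuous_finsetSum _ fun i _ => ((ContinuousLinearMap.apply ℝ (EuclideanSpace ℝ (Fin 3)) (stdOrthonormalBasis ℝ (EuclideanSpace ℝ (Fin 3)) i)).continuous).norm.pow 2 : Continuous fun L : (EuclideanSpace ℝ (Fin 3)) →L[ℝ] (EuclideanSpace ℝ (Fin 3)) => frobeniusNormSq L).comp_aestronglyMeasurable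
    h.aestronglyMeasurable_fderiv_glueSeq).restrict, ?_⟩
  rw [hasFiniteIntegral_iff_enorm]
  have hpt : ∀ z : ℝ × (EuclideanSpace ℝ (Fin 3)), ‖frobeniusNormSq (fderiv ℝ (glueSeq T τ w z.1) z.2)‖ₑ =
      ENNReal.ofReal (frobeniusNormSq (fderiv ℝ (glueSeq T τ w z.1) z.2)) := fun z =>
    Real.enorm_eq_ofReal (frobeniusNormSq_nonneg _)
  calc ∫⁻ z in Ioi (0 : ℝ) ×ˢ (univ : Set (EuclideanSpace ℝ (Fin 3))), ‖frobeniusNormSq (fderiv ℝ (glueSeq T τ w z.1) z.2)‖ₑ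
      = ∫⁻ z in Ioi (0 : ℝ) ×ˢ (univ : Set (EuclideanSpace ℝ (Fin 3))),
          ENNReal.ofReal (frobeniusNormSq (fderiv ℝ (glueSeq T τ w z.1) z.2)) := lintegral_congr hpt
    _ ≤ ∫⁻ z : ℝ × (EuclideanSpace ℝ (Fin 3)), ENNReal.ofReal (frobeniusNormSq (fderiv ℝ (glueSeq T τ w z.1) z.2)) :=
        setLIntegral_le_lintegral _ _
    _ < ⊤ := h.lintegral_frobeniusNormSq_fderiv_glueSeq_lt_top

/-! ### The glued field is a weak NSI solution; discharge of `NSICantorSwitching` -/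

/-- **The glued field of a Cantor block is a weak solution of the Navier–Stokes inequality on
`ℝ³ × (0,∞)` for every `ν ∈ [0, ν₀]`** (Ożański 2017, p. 30: "that `𝔲` is a weak solution to
the NSI follows as in the case of Theorem 1"; Scheffer 1987, Lemmas 5.9–5.13), by the accepted
gluing principle `isWeakNSISolution_of_piecewise`. PROVED.
[cite: Ozanski2017NSISingular, §6.2 p. 30 and §2 pp. 6–7] [cite: Scheffer1987, Lemmas 5.9–5.13] -/
theorem isWeakNSISolution_glueSeq (h : IsNSICantorBlock T ν₀ τ M d G w) {ν : ℝ}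
    (hν : ν ∈ Icc 0 ν₀) :
    IsWeakNSISolution ν (glueSeq T τ w) fun t => normalisedPressure (glueSeq T τ w t) := by
  have hQ : ((positiveTimes : Opens (ℝ × (EuclideanSpace ℝ (Fin 3)))) : Set (ℝ × (EuclideanSpace ℝ (Fin 3)))) = Ioi 0 ×ˢ univ := coe_positiveTimes
  refine isWeakNSISolution_of_piecewise (t := switchTime T τ) (T₀ := blowupTime T τ)
    (v := w) (q := fun j s x => normalisedPressure (w j s) x) (Gr := fun t x => fderiv ℝ (glueSeq T τ w t) x)
    (strictMono_switchTime h.T_pos h.τ_pos) (switchTime_zero T τ)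
    (tendsto_switchTime h.τ_pos.le h.τ_lt_one) (fun j s hs => ?_) (fun s hs => ?_)
    (fun j s hs => (h.contDiff_piece hs).of_le (by exact_mod_cast le_top))
    (fun j s hs => h.divFree j s (Ico_subset_Icc_self hs)) h.drop
    (fun j φ hφ hφ0 => h.localEnergyIneq_piece hν j (hφ.mono le_top) hφ0)
    (fun j s hs => ⟨memLp_normalisedPressure_three_halves (h.contDiff_piece (Ico_subset_Icc_self hs))
        (h.hasCompactSupport_piece (Ico_subset_Icc_self hs)), fun ψ hψ =>
      integral_normalisedPressure_mul_laplacian (h.contDiff_piece (Ico_subset_Icc_self hs))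
        (h.hasCompactSupport_piece (Ico_subset_Icc_self hs)) (contDiff_infty.1 hψ.contDiff 2)
        hψ.hasCompactSupport⟩)
    ?_ ?_ ?_ ?_ ?_ ?_ ?_ ?_
  · -- agreement on the pieces
    have hu := glueSeq_eq_of_mem h.T_pos h.τ_pos w hs
    refine ⟨hu, ?_, ?_⟩
    · funext x
      simp only [hu]
    · funext x
      simp only [hu]
  · -- vanishing from `T₀` on
    have hu := glueSeq_eq_zero_of_le h.T_pos h.τ_pos h.τ_lt_one w hs
    refine ⟨hu, ?_, ?_⟩
    · funext x
      simp only [hu, normalisedPressure_zero]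
    · funext x
      simp [hu]
  · -- energy class
    obtain ⟨C, hC⟩ := h.exists_lintegral_glueSeq_le
    exact ⟨C, ENNReal.coe_lt_top, fun s _ => hC s⟩
  · rw [hQ]; exact h.integrable_glueSeq.integrableOn
  · rw [hQ]; exact h.integrable_fderiv_glueSeq.integrableOn
  · rw [hQ]; exact h.aestronglyMeasurable_normalisedPressure_glueSeq
  · rw [hQ]; exact h.integrable_norm_sq
  · rw [hQ]; exact h.integrable_norm_cube
  · rw [hQ]; exact h.integrable_abs_pressure_mul_norm
  · rw [hQ]; exact h.integrable_frobeniusNormSq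

end IsNSICantorBlock

/-- **Discharge of fact A′ (`NSICantorSwitching`; Ożański 2017, §6.2 (6.18) and p. 30;
Scheffer 1987, (5.39) with Lemmas 5.9–5.13).** For every Cantor block the glued field
`𝔲 = Scheffer.glueSeq T τ w` agrees with `w j` on `[t_j, t_{j+1})`, vanishes from `T₀` on, is a
weak NSI solution for every `ν ∈ [0,ν₀]` (`IsNSICantorBlock.isWeakNSISolution_glueSeq`), and has
`C^∞` slices supported in `G`. PROVED. [cite: Ozanski2017NSISingular, §6.2 (6.18) and p. 30]
[cite: Scheffer1987, (5.39) and Lemmas 5.9–5.13] -/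
theorem NSICantorSwitching_holds : NSICantorSwitching := by
  intro T ν₀ τ M d G w hb
  exact ⟨glueSeq T τ w, fun j t ht => glueSeq_eq_of_mem hb.T_pos hb.τ_pos w ht,
    fun t ht => glueSeq_eq_zero_of_le hb.T_pos hb.τ_pos hb.τ_lt_one w ht,
    fun ν hν => hb.isWeakNSISolution_glueSeq hν,
    fun t _ => ⟨hb.contDiff_glueSeq t, hb.tsupport_glueSeq_subset t⟩⟩

/-- **Scheffer's 1987 theorem from the Cantor block alone.** The barrier fact
`NavierStokesInequalityNearlyOneDimSingularSet` (Scheffer 1987 = Ożański 2020, Thm. 1.6) follows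
from the existence of the Cantor block B′ = `NSICantorBlockExists` (Ożański 2017, §6.5 geometric
arrangement + Prop. 16), by the accepted assembly
`navierStokesInequalityNearlyOneDimSingularSet_of_cantorSwitching` and the discharge
`NSICantorSwitching_holds`; the trust base of the fact is thus the single named fact B′. PROVED.
[cite: Ozanski2017NSISingular, §6.2 p. 30] [cite: Scheffer1987, p. 551] -/
theorem navierStokesInequalityNearlyOneDimSingularSet_of_blockExists (hB : NSICantorBlockExists) :
    NavierStokesInequalityNearlyOneDimSingularSet :=
  navierStokesInequalityNearlyOneDimSingularSet_of_cantorSwitching NSICantorSwitching_holds hB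

end Literature.Barriers.NavierStokesRegularity
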